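import Mathlib
import Literature.MathematicalPhysics.StatisticalMechanics.BarlowStacking
import Literature.MathematicalPhysics.StatisticalMechanics.LennardJonesClusters

/-!
# Route `NashClassCertificates`, crux `NashNearField` (stmt-AtomisticToContinuum-16827), line `birth`:
# pieces for the stub `stub_localSmoothCertificateOfSitewise` (SITEWISE ⇒ LSC), III — the affine-exact case

Sanity piece documenting that all the difficulty of SITEWISE ⇒ LSC is in `ν > 0` (and in the drift of the charts):
if the WHOLE cluster `Ω` is an exact finite piece of ONE strained stacking, `x j = x₀ + G (barlowPos 1 (√6/3) s (σ j))`
with an injective labelling `σ`, then the local smooth certificate at every site whose image-8-ball is complete in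
`Ω` follows from the sitewise landscape bound with an EXPLICIT transfer and zero residual:

* the missing template sites (outside `Ω`) are farther than `8` from the centre, where `V_LJ ≤ 0`, so dropping them
  only raises the partial site energy (`lennardJones_nonpos`, Literature; `tsum` split);
* the inter-layer corrector `w` of SITEWISE is realised by the single-partner layer flux
  `τ i j = −w(m_i)` if `σ j = σ i + (1,0,0)`, `= w(m_j)` if `σ i = σ j + (1,0,0)`, `0` otherwise (antisymmetric; the
  partner bond has unit template length, so `|τ| ≤ C_w (6/5)⁶ d⁻⁶ ≤ 3 C_w d⁻⁶`);
* SITEWISE is centred at `(m,0,0)`; `tsum_strainedSite_centre` moves the centre to any site of layer `m`.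

`stub_lscAffineExact` takes the SITEWISE conclusion for `(s, G)` (any level `E`, e.g. `e* + κ r²`) and the
summability of the strained site series as hypotheses and concludes `E ≤ ½Σ_{j∈Ω∖i} V(|x i − x j|) + Σ_{j∈Ω} τ i j`.
All `[folklore]`.
-/

noncomputable section

open scoped BigOperators
open Literature.MathematicalPhysics.StatisticalMechanics

namespace Summit.AtomisticToContinuum.Crystallization.Theorems.NashClassCertificatesNashNearField

/-- Relative template positions only depend on relative in-layer labels. [folklore] -/
theorem barlowPos_sub_shift (h : ℝ) (s : ℤ → ℤ) (k i j m a c : ℤ) :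
    barlowPos 1 h s k i j - barlowPos 1 h s m a c = barlowPos 1 h s k (i - a) (j - c) - barlowPos 1 h s m 0 0 := by
  ext l
  fin_cases l <;> simp [barlowPos_apply_zero, barlowPos_apply_one, barlowPos_apply_two] <;> ring

/-- **The strained site series does not depend on the in-layer position of the centre.**  For any map `Φ` of the
relative position, `Σ'_{q ≠ (m,a,c)} Φ (b_q − b_{(m,a,c)}) = Σ'_{q ≠ (m,0,0)} Φ (b_q − b_{(m,0,0)})` (relabel
`(k,i,j) ↦ (k, i−a, j−c)`). [folklore] -/
theorem tsum_strainedSite_centre (h : ℝ) (s : ℤ → ℤ) (Φ : EuclideanSpace ℝ (Fin 3) → ℝ) (m a c : ℤ) :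
    (∑' q : {q : ℤ × ℤ × ℤ // q ≠ (m, a, c)},
        Φ (barlowPos 1 h s q.1.1 q.1.2.1 q.1.2.2 - barlowPos 1 h s m a c)) =
      ∑' q : {q : ℤ × ℤ × ℤ // q ≠ (m, 0, 0)},
        Φ (barlowPos 1 h s q.1.1 q.1.2.1 q.1.2.2 - barlowPos 1 h s m 0 0) := by
  let e : {q : ℤ × ℤ × ℤ // q ≠ (m, a, c)} ≃ {q : ℤ × ℤ × ℤ // q ≠ (m, 0, 0)} :=
    { toFun := fun q => ⟨(q.1.1, q.1.2.1 - a, q.1.2.2 - c), by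
        intro hq
        apply q.2
        simp only [Prod.mk.injEq] at hq
        obtain ⟨h1, h2, h3⟩ := hq
        ext <;> simp <;> omega⟩
      invFun := fun q => ⟨(q.1.1, q.1.2.1 + a, q.1.2.2 + c), by
        intro hq
        apply q.2
        simp only [Prod.mk.injEq] at hq
        obtain ⟨h1, h2, h3⟩ := hq
        ext <;> simp <;> omega⟩
      left_inv := fun q => by ext <;> simp
      right_inv := fun q => by ext <;> simp }
  rw [← e.tsum_eq]
  refine tsum_congr fun q => ?_
  change _ = Φ (barlowPos 1 h s q.1.1 (q.1.2.1 - a) (q.1.2.2 - c) - barlowPos 1 h s m 0 0)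
  rw [barlowPos_sub_shift]

/-- **Stub piece `stub_lscAffineExact`: the local smooth certificate in the affine-exact case (proved).**  Let the
cluster `Ω` be an exact piece of one strained stacking — `x j = x₀ + G (barlowPos 1 (√6/3) s (σ j))` for `j ∈ Ω`,
`σ` injective on `Ω`, `s` a Hägg word, `G` bi-Lipschitz with constants `4/5, 6/5` — and let the sitewise landscape
bound hold for `(s, G)` at some level `E` with a bounded inter-layer corrector `w` (the conclusion of SITEWISE:
`E ≤ ½Σ'_{q≠(m,0,0)} V‖G(b_q − b_{(m,0,0)})‖ + w(m−1) − w(m)` for every layer `m`, `|w| ≤ C_w`), the strained site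
series being summable.  Then the explicit single-partner layer flux `τ` (antisymmetric, `|τ i j| ≤ 3 C_w |x i − x j|⁻⁶`)
gives `E ≤ ½Σ_{j∈Ω∖i} V(|x i − x j|) + Σ_{j∈Ω} τ i j` at every `i ∈ Ω` whose template sites within image-distance `8`
are all occupied — the LSC inequality with ZERO residual (`ν = 0`): the sites outside `Ω` are farther than `8`,
where `V ≤ 0`. [folklore] -/
theorem stub_lscAffineExact :
    ∀ (N : ℕ) (x : Fin N → EuclideanSpace ℝ (Fin 3)) (Ω : Finset (Fin N)) (x₀ : EuclideanSpace ℝ (Fin 3))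
      (s : ℤ → ℤ) (G : EuclideanSpace ℝ (Fin 3) →L[ℝ] EuclideanSpace ℝ (Fin 3)) (σ : Fin N → ℤ × ℤ × ℤ)
      (w : ℤ → ℝ) (Cw E : ℝ),
      IsHaggSeq s → (∀ v : EuclideanSpace ℝ (Fin 3), 4 / 5 * ‖v‖ ≤ ‖G v‖ ∧ ‖G v‖ ≤ 6 / 5 * ‖v‖) →
      (∀ j ∈ Ω, x j = x₀ + G (barlowPos 1 (Real.sqrt 6 / 3) s (σ j).1 (σ j).2.1 (σ j).2.2)) → Set.InjOn σ ↑Ω →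
      (∀ n : ℤ, |w n| ≤ Cw) →
      (∀ m : ℤ, E ≤ (1 / 2 : ℝ) * (∑' q : {q : ℤ × ℤ × ℤ // q ≠ (m, 0, 0)},
          lennardJones ‖G (barlowPos 1 (Real.sqrt 6 / 3) s q.1.1 q.1.2.1 q.1.2.2 -
            barlowPos 1 (Real.sqrt 6 / 3) s m 0 0)‖) + w (m - 1) - w m) →
      (∀ q₀ : ℤ × ℤ × ℤ, Summable fun q : {q : ℤ × ℤ × ℤ // q ≠ q₀} =>
          lennardJones ‖G (barlowPos 1 (Real.sqrt 6 / 3) s q.1.1 q.1.2.1 q.1.2.2 -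
            barlowPos 1 (Real.sqrt 6 / 3) s q₀.1 q₀.2.1 q₀.2.2)‖) →
      ∃ τ : Fin N → Fin N → ℝ, (∀ i j : Fin N, τ i j = -τ j i) ∧
        (∀ i j : Fin N, |τ i j| ≤ 3 * Cw * (dist (x i) (x j))⁻¹ ^ 6) ∧
        ∀ i ∈ Ω, (∀ q : ℤ × ℤ × ℤ, ‖G (barlowPos 1 (Real.sqrt 6 / 3) s q.1 q.2.1 q.2.2 -
            barlowPos 1 (Real.sqrt 6 / 3) s (σ i).1 (σ i).2.1 (σ i).2.2)‖ ≤ 8 → ∃ j ∈ Ω, σ j = q) →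
          E ≤ (1 / 2 : ℝ) * (∑ j ∈ Ω.erase i, lennardJones (dist (x i) (x j))) + ∑ j ∈ Ω, τ i j := by
  intro N x Ω x₀ s G σ w Cw E hs hG hx hσ hw hSW hsum
  classical
  -- notation
  set b : ℤ × ℤ × ℤ → EuclideanSpace ℝ (Fin 3) := fun q => barlowPos 1 (Real.sqrt 6 / 3) s q.1 q.2.1 q.2.2 with hb
  set up : ℤ × ℤ × ℤ := ((1 : ℤ), (0 : ℤ), (0 : ℤ)) with hup
  have hCw : 0 ≤ Cw := (abs_nonneg (w 0)).trans (hw 0)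
  -- the partner bond has unit template length, hence length in `[4/5, 6/5]`
  have hunit : ∀ q : ℤ × ℤ × ℤ, ‖b (q + up) - b q‖ = 1 := by
    intro q
    show ‖barlowPos 1 (Real.sqrt 6 / 3) s (q + up).1 (q + up).2.1 (q + up).2.2 -
      barlowPos 1 (Real.sqrt 6 / 3) s q.1 q.2.1 q.2.2‖ = 1
    simp only [hup, Prod.fst_add, Prod.snd_add, add_zero]
    rw [← dist_eq_norm, dist_barlowPos_succ_eq 1 (Real.sqrt 6 / 3) hs]
    have h6 : Real.sqrt 6 ^ 2 = 6 := Real.sq_sqrt (by norm_num)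
    rw [show (1 : ℝ) ^ 2 / 3 + (Real.sqrt 6 / 3) ^ 2 = 1 by nlinarith [h6]]
    exact Real.sqrt_one
  -- positions
  have hxx : ∀ i ∈ Ω, ∀ j ∈ Ω, x i - x j = G (b (σ i) - b (σ j)) := by
    intro i hi j hj
    rw [hx i hi, hx j hj, map_sub]
    abel
  have hdist : ∀ i ∈ Ω, ∀ j ∈ Ω, dist (x i) (x j) = ‖G (b (σ j) - b (σ i))‖ := by
    intro i hi j hj
    rw [dist_eq_norm, hxx i hi j hj, ← norm_neg, ← map_neg, neg_sub]
  -- the single-partner layer flux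
  let τ : Fin N → Fin N → ℝ := fun i j =>
    if i ∈ Ω ∧ j ∈ Ω ∧ σ j = σ i + up then -w (σ i).1
    else if i ∈ Ω ∧ j ∈ Ω ∧ σ i = σ j + up then w (σ j).1 else 0
  have hexcl : ∀ q q' : ℤ × ℤ × ℤ, q' = q + up → ¬ q = q' + up := by
    intro q q' h1 h2
    have h3 := congrArg Prod.fst h2
    rw [h1, hup] at h3
    simp only [Prod.fst_add] at h3
    omega
  refine ⟨τ, fun i j => ?_, fun i j => ?_, fun i hi hhit => ?_⟩
  · -- antisymmetry
    simp only [τ]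
    by_cases h1 : i ∈ Ω ∧ j ∈ Ω ∧ σ j = σ i + up
    · have h2 : ¬ (j ∈ Ω ∧ i ∈ Ω ∧ σ i = σ j + up) := fun h => hexcl _ _ h1.2.2 h.2.2
      have h3 : j ∈ Ω ∧ i ∈ Ω ∧ σ j = σ i + up := ⟨h1.2.1, h1.1, h1.2.2⟩
      rw [if_pos h1, if_neg h2, if_pos h3]
    · rw [if_neg h1]
      by_cases h4 : i ∈ Ω ∧ j ∈ Ω ∧ σ i = σ j + up
      · have h5 : j ∈ Ω ∧ i ∈ Ω ∧ σ i = σ j + up := ⟨h4.2.1, h4.1, h4.2.2⟩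
        rw [if_pos h4, if_pos h5, neg_neg]
      · rw [if_neg h4]
        have h6 : ¬ (j ∈ Ω ∧ i ∈ Ω ∧ σ i = σ j + up) := fun h => h4 ⟨h.2.1, h.1, h.2.2⟩
        have h7 : ¬ (j ∈ Ω ∧ i ∈ Ω ∧ σ j = σ i + up) := fun h => h1 ⟨h.2.1, h.1, h.2.2⟩
        rw [if_neg h6, if_neg h7, neg_zero]
  · -- the envelope
    simp only [τ]
    have key : ∀ i j : Fin N, i ∈ Ω → j ∈ Ω → σ j = σ i + up → ∀ t : ℝ, |t| ≤ Cw →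
        |t| ≤ 3 * Cw * (dist (x i) (x j))⁻¹ ^ 6 := by
      intro i j hi hj hq t ht
      have hd : dist (x i) (x j) = ‖G (b (σ i + up) - b (σ i))‖ := by rw [hdist i hi j hj, hq]
      have hlen := hunit (σ i)
      obtain ⟨hlo, hhi⟩ := hG (b (σ i + up) - b (σ i))
      rw [hlen] at hlo hhi
      have hdpos : 0 < dist (x i) (x j) := by rw [hd]; linarith
      have hdle : dist (x i) (x j) ≤ 6 / 5 := by rw [hd]; linarith
      have hinv : (5 / 6 : ℝ) ≤ (dist (x i) (x j))⁻¹ := by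
        rw [show (5 / 6 : ℝ) = (6 / 5 : ℝ)⁻¹ by norm_num]
        exact inv_anti₀ hdpos hdle
      have hpow : (5 / 6 : ℝ) ^ 6 ≤ (dist (x i) (x j))⁻¹ ^ 6 := pow_le_pow_left₀ (by norm_num) hinv 6
      have hnum : (1 : ℝ) ≤ 3 * (5 / 6 : ℝ) ^ 6 := by norm_num
      calc |t| ≤ Cw := ht
        _ ≤ 3 * Cw * (5 / 6 : ℝ) ^ 6 := by nlinarith [hCw, hnum]
        _ ≤ 3 * Cw * (dist (x i) (x j))⁻¹ ^ 6 := mul_le_mul_of_nonneg_left hpow (by positivity)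
    by_cases h1 : i ∈ Ω ∧ j ∈ Ω ∧ σ j = σ i + up
    · rw [if_pos h1]
      have := key i j h1.1 h1.2.1 h1.2.2 (-w (σ i).1) (by rw [abs_neg]; exact hw _)
      exact this
    · rw [if_neg h1]
      by_cases h4 : i ∈ Ω ∧ j ∈ Ω ∧ σ i = σ j + up
      · rw [if_pos h4]
        have := key j i h4.2.1 h4.1 h4.2.2 (w (σ j).1) (hw _)
        rwa [dist_comm] at this
      · rw [if_neg h4, abs_zero]
        positivity
  · -- the certificate at `i`
    have hhit' : ∀ q : ℤ × ℤ × ℤ, ‖G (b q - b (σ i))‖ ≤ 8 → ∃ j ∈ Ω, σ j = q := fun q hq => hhit q hq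
    -- the two partners are present
    have hGle : ∀ q : ℤ × ℤ × ℤ, ‖G (b (q + up) - b q)‖ ≤ 8 := fun q => by
      have := (hG (b (q + up) - b q)).2; rw [hunit q] at this; linarith
    obtain ⟨ju, hjuΩ, hju⟩ := hhit' (σ i + up) (hGle (σ i))
    obtain ⟨jd, hjdΩ, hjd⟩ := hhit' (σ i - up) (by
      have h := hGle (σ i - up)
      rw [sub_add_cancel] at h
      have e : G (b (σ i - up) - b (σ i)) = -(G (b (σ i) - b (σ i - up))) := by rw [← map_neg, neg_sub]
      rw [e, norm_neg]
      exact h)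
    have hjud : ju ≠ jd := by
      intro h; rw [h, hjd] at hju
      have h' := congrArg Prod.fst hju
      simp only [hup, Prod.fst_add, Prod.fst_sub] at h'
      omega
    -- the transfer sum: only the two partners contribute
    have hτsum : ∑ j ∈ Ω, τ i j = -w (σ i).1 + w ((σ i).1 - 1) := by
      rw [Finset.sum_eq_add_of_mem ju jd hjuΩ hjdΩ hjud]
      · simp only [τ]
        have h1 : i ∈ Ω ∧ ju ∈ Ω ∧ σ ju = σ i + up := ⟨hi, hjuΩ, hju⟩
        have h2 : ¬ (i ∈ Ω ∧ jd ∈ Ω ∧ σ jd = σ i + up) := by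
          rintro ⟨-, -, h⟩; rw [hjd] at h
          have h' := congrArg Prod.fst h
          simp only [hup, Prod.fst_add, Prod.fst_sub] at h'
          omega
        have h3 : i ∈ Ω ∧ jd ∈ Ω ∧ σ i = σ jd + up := ⟨hi, hjdΩ, by rw [hjd, sub_add_cancel]⟩
        rw [if_pos h1, if_neg h2, if_pos h3, hjd]
        simp [hup]
      · intro j hj hne
        simp only [τ]
        have h1 : ¬ (i ∈ Ω ∧ j ∈ Ω ∧ σ j = σ i + up) := by
          rintro ⟨-, -, h⟩
          exact hne.1 (hσ hj hjuΩ (h.trans hju.symm))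
        have h2 : ¬ (i ∈ Ω ∧ j ∈ Ω ∧ σ i = σ j + up) := by
          rintro ⟨-, -, h⟩
          apply hne.2 (hσ hj hjdΩ ?_)
          rw [hjd, h, add_sub_cancel_right]
        rw [if_neg h1, if_neg h2]
    -- SITEWISE at the centre `σ i`, moved from `(m,0,0)` to `(m,a,c)`
    have hSWi := hSW (σ i).1
    rw [← tsum_strainedSite_centre (Real.sqrt 6 / 3) s (fun v => lennardJones ‖G v‖) (σ i).1 (σ i).2.1 (σ i).2.2]
      at hSWi
    -- split the site series into the occupied sites and the (non-positive) rest
    set g : {q : ℤ × ℤ × ℤ // q ≠ ((σ i).1, (σ i).2.1, (σ i).2.2)} → ℝ := fun q =>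
      lennardJones ‖G (barlowPos 1 (Real.sqrt 6 / 3) s q.1.1 q.1.2.1 q.1.2.2 -
        barlowPos 1 (Real.sqrt 6 / 3) s (σ i).1 (σ i).2.1 (σ i).2.2)‖ with hgdef
    have hσi : ((σ i).1, (σ i).2.1, (σ i).2.2) = σ i := rfl
    have hgsum : Summable g := by
      have := hsum (σ i)
      exact this
    set F : Finset {q : ℤ × ℤ × ℤ // q ≠ ((σ i).1, (σ i).2.1, (σ i).2.2)} :=
      ((Ω.erase i).image σ).subtype (fun q => q ≠ ((σ i).1, (σ i).2.1, (σ i).2.2)) with hFdef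
    have hsplit := hgsum.sum_add_tsum_subtype_compl F
    -- the rest is non-positive: unoccupied sites are farther than 8
    have hrest : (∑' q : {q // q ∉ F}, g q) ≤ 0 := by
      refine tsum_nonpos fun q => ?_
      apply lennardJones_nonpos
      by_contra hlt
      push Not at hlt
      have h8 : ‖G (barlowPos 1 (Real.sqrt 6 / 3) s q.1.1.1 q.1.1.2.1 q.1.1.2.2 -
          barlowPos 1 (Real.sqrt 6 / 3) s (σ i).1 (σ i).2.1 (σ i).2.2)‖ ≤ 8 := by linarith
      obtain ⟨j, hjΩ, hjq⟩ := hhit' q.1.1 h8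
      apply q.2
      have hmem : (q.1 : {r : ℤ × ℤ × ℤ // r ≠ ((σ i).1, (σ i).2.1, (σ i).2.2)}) ∈ F := by
        simp only [hFdef, Finset.mem_subtype, Finset.mem_image]
        refine ⟨j, Finset.mem_erase.2 ⟨?_, hjΩ⟩, hjq⟩
        rintro rfl
        exact q.1.2 (by rw [← hjq])
      exact hmem
    -- the occupied part is the partial site energy
    have hall' : ∀ q ∈ (Ω.erase i).image σ, q ≠ ((σ i).1, (σ i).2.1, (σ i).2.2) := by
      intro q hq
      rw [Finset.mem_image] at hq
      obtain ⟨j, hj, rfl⟩ := hq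
      rw [hσi]
      intro h
      exact (Finset.mem_erase.1 hj).1 (hσ (Finset.mem_of_mem_erase hj) hi h)
    have hocc : ∑ q ∈ F, g q = ∑ j ∈ Ω.erase i, lennardJones (dist (x i) (x j)) := by
      have h1 : ∑ q ∈ F, g q = ∑ q ∈ (Ω.erase i).image σ, lennardJones ‖G (b q - b (σ i))‖ := by
        rw [hFdef]
        exact Finset.sum_subtype_of_mem (fun r : ℤ × ℤ × ℤ => lennardJones ‖G (b r - b (σ i))‖) hall'
      rw [h1, Finset.sum_image (fun j hj j' hj' h => hσ (Finset.mem_of_mem_erase hj) (Finset.mem_of_mem_erase hj') h)]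
      refine Finset.sum_congr rfl fun j hj => ?_
      rw [hdist i hi j (Finset.mem_of_mem_erase hj)]
    rw [hτsum]
    have hT : (∑' q, g q) ≤ ∑ j ∈ Ω.erase i, lennardJones (dist (x i) (x j)) := by
      rw [← hsplit, hocc]; linarith
    have hE : E ≤ (1 / 2 : ℝ) * (∑' q, g q) + w ((σ i).1 - 1) - w (σ i).1 := hSWi
    linarith

end Summit.AtomisticToContinuum.Crystallization.Theorems.NashClassCertificatesNashNearField

end
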